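import Literature.AnabelianGeometry.SemiGraphs.ThetaRayRefutation
import Literature.AnabelianGeometry.SemiGraphs.TemperedReconstructionR3cOfTwoHosts
import Literature.AnabelianGeometry.SemiGraphs.TemperedCompactCentralizerInVerticial
import HarnessLib

/-!
# `𝒢_θ` satisfies the hypotheses of [SemiAnbd] Cor 3.9; the Cor-3.9-restricted residual of (R3c) is refuted,
# and (R3c) at `𝒢_θ` reduces to conj 2 of Thm 3.7 (iii) at the open edge pieces (proof-only)

Mochizuki, *Semi-graphs of anabelioids*, Publ. RIMS **42** (2006), §3, Corollary 3.9 p. 42 (hypotheses: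
"connected, countable, quasi-coherent, totally elevated, totally estranged, verticially slim graphs of
anabelioids"), proof p. 43 l. 13 "[again by Theorem 3.7, (iii), (iv)]"; Theorem 3.7 (iii) pp. 40–41
[cite: MochizukiSemiAnbd2006, Cor 3.9 p.42].

PROOF-ONLY file (abc-iut cell, block F fact-proving wave, seat abc-iut-f-176 gen 2; FACT-LIST rows F-2772
`EdgeLikeCentralizerAt` / F-2773 `EdgeLikeCentralizer`; no definition, no named fact, nothing of the custody
files altered), three small consequences of abc-iut-L3-d4's ✓ `thetaRayFreeProP_not_compactInVerticialAt`
(`ThetaRayRefutation.lean`, programme REFUTE-F1732) for the Cor. 3.9 side: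

* `thetaRayFreeProP_cor39Hypotheses` — the countermodel `𝒢_θ(p, n)` (the ray of free pro-`p` groups of rank 2,
  abc-iut-L3-d1) satisfies `Cor39Hypotheses` UNCONDITIONALLY: it satisfies `Thm37Hypotheses`
  (`thetaRayFreeProP_thm37Hypotheses'`) and its underlying semi-graph, the ray, is a graph;
* `not_forall_cor39Hypotheses_compactInVerticialAt` — hence the hypothesis
  `∀ ℋ, Cor39Hypotheses ℋ → CompactInVerticialAt ℋ` of the tree's only producer of F-2773 beyond finite
  graphs, `edgeLikeCentralizer_of_compactInVerticialAt_cor39` (TemperedReconstructionR3cFinite.lean), is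
  FALSE in the kernel (at `n k := k + 1`, `p = 2`): that conditional closer is vacuous, which is what the
  sharpened residual of `TemperedReconstructionR3cOfTwoHosts.lean` repairs;
* `thetaRayFreeProP_edgeLikeCentralizerAt_of_twoHostsAt` — AT `𝒢_θ` (an UNTANGLED graph: `SemiGraph.ray_isUntangled`)
  the schema F-2772 `EdgeLikeCentralizerAt 𝒢_θ c`, for every chart `c`, follows from ONE input: conj 2 of
  Thm. 3.7 (iii) at the open pieces `ψ(U)` of the edge-like subgroups of `π₁^temp(𝒢_θ)` — the precise
  target for the cell's row «F-2772/F-2773 at 𝒢_θ, prove-or-refute» (abc-iut-L3-d1), conj 1 being refuted there.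
* (appended) `thetaRayFreeProP_edgeLikeCentralizerAt` — F-2772 `EdgeLikeCentralizerAt 𝒢_θ c` HOLDS, every chart,
  unconditionally, through abc-iut-f-172's `edgeLikeCentralizerAt_of_isLocallyFinite` (the ray is locally finite);
  `thetaRayFreeProP_edgeLikeCentralizerAt_and_not_compactInVerticialAt` — (R3c) holds at `𝒢_θ` while the first
  sentence of Thm. 3.7 (iii) fails there.

Honest framing: erratum-grade bookkeeping about the cell's ∀-countable TYPINGS; outside the [IUTchIII]
Cor. 3.12 cone (every print consumer of Cor. 3.9 has a finite dual graph, where (R3c) and Thm. 3.7 (iii) are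
kernel theorems); nothing printed is refuted; no side taken on [IUTchIII] Cor. 3.12; typed ≠ proved.
-/

noncomputable section

namespace Literature.AnabelianGeometry.SemiGraphs

namespace ProfiniteSemiGraph

open Topology

variable (p : ℕ) [hp : Fact p.Prime] (n : ℕ → ℕ)

/-- **`𝒢_θ(p, n)` satisfies the hypotheses of [SemiAnbd] Cor. 3.9** ("connected, countable, quasi-coherent,
totally elevated, totally estranged, verticially slim graphs of anabelioids", with Galois-countability and a
vertex as in `Prop36Hypotheses`): `Thm37Hypotheses` by `thetaRayFreeProP_thm37Hypotheses'` (bricks R1–R5 of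
REFUTE-F1732) and the ray is a graph (`thetaRayFreeProP_isGraph`). [cite: MochizukiSemiAnbd2006, Cor 3.9 p.42] -/
theorem thetaRayFreeProP_cor39Hypotheses : (thetaRayFreeProP p n).Cor39Hypotheses where
  toProp36Hypotheses := (thetaRayFreeProP_thm37Hypotheses' p n).toProp36Hypotheses
  isTotallyEstranged := (thetaRayFreeProP_thm37Hypotheses' p n).isTotallyEstranged
  isGraph := thetaRayFreeProP_isGraph p n

/-- **The Cor-3.9-restricted form of Thm. 3.7 (iii) is FALSE**: not every graph of anabelioids satisfying the
hypotheses of Cor. 3.9 satisfies `CompactInVerticialAt` — countermodel `𝒢_θ(2, k ↦ k + 1)`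
(`thetaRayFreeProP_not_compactInVerticialAt`).  This is exactly the hypothesis `hCV` of the tree's
`edgeLikeCentralizer_of_compactInVerticialAt_cor39` (the residual producer of FACT-LIST F-2773 beyond finite
graphs), which is therefore vacuous. [cite: MochizukiSemiAnbd2006, Thm 3.7(iii) pp.40-41] -/
theorem not_forall_cor39Hypotheses_compactInVerticialAt :
    ¬ ∀ ℋ : ProfiniteSemiGraph.{0}, Cor39Hypotheses ℋ → CompactInVerticialAt ℋ := fun h =>
  haveI : Fact (Nat.Prime 2) := ⟨Nat.prime_two⟩
  thetaRayFreeProP_not_compactInVerticialAt 2 (fun k => k + 1) (fun k => Nat.le_succ k)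
    (h _ (thetaRayFreeProP_cor39Hypotheses 2 fun k => k + 1))

/-- The same for the Thm-3.7-restricted form with the graph condition (the shape in which the L3 conditional
certificates bind Thm. 3.7 (iii) per graph): FALSE. [cite: MochizukiSemiAnbd2006, Thm 3.7(iii) pp.40-41] -/
theorem not_forall_thm37Hypotheses_isGraph_compactInVerticialAt :
    ¬ ∀ ℋ : ProfiniteSemiGraph.{0}, ℋ.Thm37Hypotheses → ℋ.IsGraph → CompactInVerticialAt ℋ := fun h =>
  haveI : Fact (Nat.Prime 2) := ⟨Nat.prime_two⟩
  thetaRayFreeProP_not_compactInVerticialAt 2 (fun k => k + 1) (fun k => Nat.le_succ k)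
    (h _ (thetaRayFreeProP_thm37Hypotheses' 2 fun k => k + 1) (thetaRayFreeProP_isGraph 2 fun k => k + 1))

/-- **(R3c) AT `𝒢_θ` reduces to conj 2 of Thm. 3.7 (iii) at the open edge pieces** (the ray is untangled, so
`edgeLikeCentralizerAt_of_twoHostsAt_of_isUntangled` applies; conj 1, refuted at `𝒢_θ`, is not needed): for
every chart `c` of `π₁^temp(𝒢_θ(p, n))`, IF for every edge homomorphism `ψ` at `e` and open `U ⊆ Π_e` the
compact `ψ(U)` lies in at most two verticial subgroups, THEN `EdgeLikeCentralizerAt (𝒢_θ(p, n)) c`.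
[cite: MochizukiSemiAnbd2006, Cor 3.9 p.43] -/
theorem thetaRayFreeProP_edgeLikeCentralizerAt_of_twoHostsAt (c : TemperedPiChart (thetaRayFreeProP p n))
    (h2 : ∀ (e : (thetaRayFreeProP p n).graph.Edge) (ψ : (thetaRayFreeProP p n).Ge e →ₜ* c.G),
      IsEdgeHom c e ψ → ∀ (U : Subgroup ((thetaRayFreeProP p n).Ge e)),
      IsOpen (U : Set ((thetaRayFreeProP p n).Ge e)) →
      ∀ (v₁ v₂ : (thetaRayFreeProP p n).graph.Vertex) (H₁ H₂ : Subgroup c.G), H₁ ∈ verticialSubgroups c v₁ →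
        H₂ ∈ verticialSubgroups c v₂ → H₁ ≠ H₂ → U.map ψ.toMonoidHom ≤ H₁ → U.map ψ.toMonoidHom ≤ H₂ →
          ∀ (v₃ : (thetaRayFreeProP p n).graph.Vertex) (H₃ : Subgroup c.G), H₃ ∈ verticialSubgroups c v₃ →
            U.map ψ.toMonoidHom ≤ H₃ → H₃ = H₁ ∨ H₃ = H₂) :
    EdgeLikeCentralizerAt (thetaRayFreeProP p n) c :=
  edgeLikeCentralizerAt_of_twoHostsAt_of_isUntangled (thetaRayFreeProP_cor39Hypotheses p n)
    SemiGraph.ray_isUntangled c h2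

/-! ### (R3c) HOLDS at `𝒢_θ` — the instances of F-2772 / F-2773 at the countermodel, unconditionally
(appended by abc-iut-f-176 gen 2 after abc-iut-f-172's `edgeLikeCentralizerAt_of_isLocallyFinite` landed) -/

/-- **F-2772 `EdgeLikeCentralizerAt` HOLDS at `𝒢_θ(p, n)`, for EVERY chart and EVERY exponent sequence `n`,
unconditionally**: the ray is locally finite (`SemiGraph.ray_isLocallyFinite`) and `𝒢_θ` is a Cor-3.9 graph
(`thetaRayFreeProP_cor39Hypotheses`), so abc-iut-f-172's `edgeLikeCentralizerAt_of_isLocallyFinite` (centralisers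
of nontrivial compact subgroups at LOCALLY FINITE graphs, via abc-iut-w6-d062's adjacency clause of (FIX∞) —
neither sentence of Thm. 3.7 (iii) is used) applies.  This is the positive kernel form of the cell's row
«F-2772/F-2773 at 𝒢_θ: prove-or-refute» (abc-iut-L3-d1, desk verdict HOLDS) and supersedes the conditional
`thetaRayFreeProP_edgeLikeCentralizerAt_of_twoHostsAt` above. [cite: MochizukiSemiAnbd2006, Cor 3.9 p.43] -/
theorem thetaRayFreeProP_edgeLikeCentralizerAt (c : TemperedPiChart (thetaRayFreeProP p n)) :
    EdgeLikeCentralizerAt (thetaRayFreeProP p n) c :=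
  edgeLikeCentralizerAt_of_isLocallyFinite (thetaRayFreeProP_cor39Hypotheses p n) SemiGraph.ray_isLocallyFinite c

/-- **(R3c) survives where Thm. 3.7 (iii), first sentence, fails**: at `𝒢_θ(p, n)` with `k ≤ n k`, the step
(R3c) of the proof of Cor. 3.9 ("[again by Theorem 3.7, (iii), (iv)]", p. 43 l. 13) holds for every chart,
while `CompactInVerticialAt 𝒢_θ` is false (`thetaRayFreeProP_not_compactInVerticialAt`) — the dependence of
(R3c) on the first sentence of Thm. 3.7 (iii) in the printed proof is not essential at this graph.
[cite: MochizukiSemiAnbd2006, Cor 3.9 p.43] -/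
theorem thetaRayFreeProP_edgeLikeCentralizerAt_and_not_compactInVerticialAt (hn : ∀ k, k ≤ n k) :
    (∀ c : TemperedPiChart (thetaRayFreeProP p n), EdgeLikeCentralizerAt (thetaRayFreeProP p n) c) ∧
      ¬ CompactInVerticialAt (thetaRayFreeProP p n) :=
  ⟨thetaRayFreeProP_edgeLikeCentralizerAt p n, thetaRayFreeProP_not_compactInVerticialAt p n hn⟩

end ProfiniteSemiGraph

end Literature.AnabelianGeometry.SemiGraphs

end
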